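import Literature.AlgebraicGeometry.Motives.CartierDivisor
import Mathlib.AlgebraicGeometry.Morphisms.Separated
import Mathlib.AlgebraicGeometry.Morphisms.Immersion
import Mathlib.AlgebraicGeometry.Morphisms.UniversallyClosed
import Mathlib.FieldTheory.Galois.Basic
import Mathlib.FieldTheory.PurelyInseparable.PerfectClosure
import Mathlib.FieldTheory.Fixed
import HarnessLib

/-!
# `WildQuotients.SummitReduction` (stmt-ResolutionOfSingularities-16324), line `FramePerfect`:
# lemmas for stub `stub_pair_regularBaseChange` (de Jong 1997, 5.3–5.4: the Galois bookkeeping of the pull-back step)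

Route `ResolutionOfSingularities/WildQuotients`, crux `SummitReduction`; helper file of the line
skeleton `Cruxes/SummitReduction/Lines/FramePerfect.lean` (v6), stub `stub_pair_regularBaseChange`
(de Jong 1997, 5.4 with condition (5.4.1), used in the proof of Thm. 5.13 as "(5.12.1) for the
base": pull the `G₁`-semi-stable curve `X₁ → Y₁` back along a Galois alteration `(Y₂, G₂) → (Y₁, G₁)`
of the base with `Y₂` regular). The stub's purely inseparable clause — `K(X)^G ⊂ K(X₁ ×_{Y₁} Y₂)^{G'}`
is purely inseparable for the fibre-product group `G'` — rests on two statements of Galois theory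
and on the rigidity of morphisms into separated schemes, all PROVED here hypothesis-free:

* `pow_expChar_pow_mem_of_smul_eq_of_kernel` — de Jong 1997, 5.3: "Condition (d) is equivalent
  to the following: if `H = Ker(G' → Aut(S))` then `R(S) ⊂ R(S')^H` is purely inseparable" (the
  direction (d) ⇒ kernel form, for a finite group `G` acting on a field `E` with an invariant
  subfield `K`: if `E^G` is purely inseparable over `K`, so is the fixed field of the pointwise
  stabiliser of `K`), by the Galois correspondence for `E / E^G` and the relative perfect closure;
* `fixedPoints_le_sup_inf_fixedPoints` — the "exercise in Galois theory" of 5.4/5.5: for a finite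
  group `Γ` of automorphisms of a field `Ω = L ∨ E` fixing `L` pointwise and stabilising `E`,
  `Ω^Γ = L ∨ (E ∩ Ω^Γ)`, by Artin's theorem `[Ω : Ω^Γ] = |Γ|` against `[Ω : L ∨ E^Γ] ≤ [E : E^Γ] ≤ |Γ|`;
* `isSeparated_of_surjective_of_universallyClosed` — separatedness descends along a universally
  closed surjection (the base `Y₁` of the projective `X₁` is separated, so that `X₁ ×_{Y₁} Y₂` is a
  closed subscheme of `X₁ ×_k Y₂` and automorphisms of `Y₁` are detected on `K(Y₁)`);
* `eq_of_functionFieldMap_eq` — two dominant morphisms from an integral scheme to a separated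
  integral scheme inducing the same map of function fields coincide (so an element of `G₂` acting
  trivially on `K(Y₁) ⊂ K(Y₂)` acts on `Y₂` over `Y₁`: condition (5.4.1) for the fibre-product group).
-/

set_option linter.dupNamespace false

noncomputable section

open CategoryTheory CategoryTheory.Limits AlgebraicGeometry TopologicalSpace
open Literature.AlgebraicGeometry.Motives (RatFn.functionFieldMap RatFn.functionFieldMap_comp)
open Literature.AlgebraicGeometry

namespace Summit.ResolutionOfSingularities.ResolutionOfSingularities.Theorems

/-! ## Galois theory: invariants under the pointwise stabiliser of an invariant subfield -/

/-- **de Jong 1997, Situation 5.3, "(d) ⇔ kernel form"** (the direction used in 5.4): let a finite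
group `G` act on a field `E` of exponential characteristic `q`, and let `K ⊆ E` be a `G`-invariant
subfield such that every `G`-invariant element of `E` has a `q`-power-power in `K` (i.e. `E^G` is
purely inseparable over `K^G = K ∩ E^G`; "(d) the extension `R(S)^G ⊂ R(S')^{G'}` is purely
inseparable"). Then every element of `E` fixed by the pointwise stabiliser
`H = {g | g|_K = id}` of `K` has a `q`-power-power in `K` ("if `H = Ker(G' → Aut(S))` then
`R(S) ⊂ R(S')^H` is purely inseparable"). Proof: `E / E^G` is finite Galois and every
`E^G`-automorphism of `E` comes from `G` (`FixedPoints.toAlgAut_surjective`), so by the Galois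
correspondence an element fixed by `H` lies in the compositum `E^G(K)`, which is contained in the
relative perfect closure of `K` in `E` since `E^G` and `K` are. [cite: DeJong1997, 5.3, p. 613] -/
theorem pow_expChar_pow_mem_of_smul_eq_of_kernel {E : Type*} [Field E] (G : Type*) [Group G]
    [Finite G] [MulSemiringAction G E] (q : ℕ) [ExpChar E q] (K : Subfield E)
    [IsInvariantSubfield G K]
    (hd : ∀ a : E, (∀ g : G, g • a = a) → ∃ n : ℕ, a ^ q ^ n ∈ K)
    {b : E} (hb : ∀ g : G, (∀ x ∈ K, g • x = x) → g • b = b) :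
    ∃ n : ℕ, b ^ q ^ n ∈ K := by
  classical
  haveI : IsGalois (FixedPoints.subfield G E) E := IsGalois.of_fixed_field E G
  set FK : IntermediateField (FixedPoints.subfield G E) E :=
    IntermediateField.adjoin (FixedPoints.subfield G E) (K : Set E) with hFK
  -- `b ∈ E^G(K)` by the Galois correspondence: every automorphism over `E^G` comes from `G`
  have hbFK : b ∈ FK := by
    rw [← IsGalois.fixedField_fixingSubgroup FK, IntermediateField.mem_fixedField_iff]
    intro σ hσ
    obtain ⟨g, rfl⟩ := FixedPoints.toAlgAut_surjective G E σ
    rw [IntermediateField.mem_fixingSubgroup_iff] at hσ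
    have hg : ∀ x ∈ K, g • x = x := fun x hx => by
      have := hσ x (IntermediateField.subset_adjoin _ (K : Set E) hx)
      simpa using this
    simpa using hb g hg
  -- `E^G(K)` lies in the relative perfect closure of `K` in `E`
  haveI : ExpChar K q := RingHom.expChar K.subtype Subtype.coe_injective q
  have hle : FK.toSubfield ≤ (perfectClosure K E).toSubfield := by
    rw [hFK, IntermediateField.adjoin_toSubfield, Subfield.closure_le]
    rintro x (⟨y, rfl⟩ | hx)
    · obtain ⟨n, hn⟩ := hd y (fun g => y.2 g)
      show (y : E) ∈ perfectClosure K E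
      rw [mem_perfectClosure_iff_pow_mem q]
      exact ⟨n, ⟨⟨_, hn⟩, rfl⟩⟩
    · show x ∈ perfectClosure K E
      rw [mem_perfectClosure_iff_pow_mem q]
      exact ⟨0, ⟨⟨x, hx⟩, by rw [pow_zero, pow_one]; rfl⟩⟩
  have hbP : b ∈ perfectClosure K E := hle hbFK
  rw [mem_perfectClosure_iff_pow_mem q] at hbP
  obtain ⟨n, ⟨y, hy⟩⟩ := hbP
  exact ⟨n, hy ▸ y.2⟩

/-- **The Galois-theory exercise of de Jong 1997, 5.4–5.5** ("The verification of the last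
statement of the lemma is an exercise in Galois theory that is left to the reader"), in the form
the pull-back step uses it: let `Γ` be a finite group of automorphisms of a field `Ω`, and let
`L, E ⊆ Ω` be subfields generating `Ω` (`L ∨ E = Ω`) with `Γ` fixing `L` pointwise and mapping `E`
into itself. Then the fixed field is `Ω^Γ = L ∨ (E ∩ Ω^Γ)` (the inclusion `⊇` being obvious).
In 5.4: `Ω = K(X ×_S S')` is generated by `L = K(X)` and `E = K(S')`, and `Γ = Ker(G' → Aut X)`.
Proof: put `E₀ = E ∩ Ω^Γ` and `P = L ∨ E₀ ⊆ Ω^Γ`. The action restricts to `E` with fixed field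
`E₀`, so `[E : E₀] ≤ |Γ|` (`FixedPoints.rank_le_card`); `Ω = P(E)` with `E` algebraic over
`E₀ ⊆ P`, so `[Ω : P] ≤ [E : E₀] ≤ |Γ|` (`IntermediateField.adjoin_rank_le_of_isAlgebraic`);
and `[Ω : Ω^Γ] = |Γ|` by Artin's theorem (`FixedPoints.finrank_eq_card`, `Γ` acts faithfully).
The tower `P ⊆ Ω^Γ ⊆ Ω` forces `[Ω^Γ : P] = 1`. [cite: DeJong1997, 5.4–5.5, pp. 613–614] -/
theorem fixedPoints_le_sup_inf_fixedPoints {Ω : Type*} [Field Ω] (Γ : Subgroup (Ω ≃+* Ω))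
    [Finite Γ] (L E : Subfield Ω) (hL : ∀ σ ∈ Γ, ∀ x ∈ L, σ x = x)
    (hE : ∀ σ ∈ Γ, ∀ x ∈ E, σ x ∈ E) (hgen : L ⊔ E = ⊤) :
    FixedPoints.subfield Γ Ω ≤ L ⊔ (E ⊓ FixedPoints.subfield Γ Ω) := by
  classical
  haveI := Fintype.ofFinite Γ
  set MΓ : Subfield Ω := FixedPoints.subfield Γ Ω with hMΓdef
  set E₀ : Subfield Ω := E ⊓ MΓ with hE₀def
  set P : Subfield Ω := L ⊔ E₀ with hPdef
  have hLM : L ≤ MΓ := fun x hx σ => hL σ σ.2 x hx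
  have hPM : P ≤ MΓ := sup_le hLM inf_le_right
  -- the restricted action of `Γ` on `E`
  haveI : IsInvariantSubfield Γ E := ⟨fun σ x hx => hE σ σ.2 x hx⟩
  -- `E` as an intermediate field over `E₀ = E ∩ Ω^Γ`
  let E' : IntermediateField E₀ Ω := E.toIntermediateField fun x => x.2.1
  -- Artin's bound for the restricted action: `[E : E₀] ≤ |Γ|`
  have hrankE : Module.rank E₀ E' ≤ Fintype.card Γ := by
    refine le_trans ?_ (FixedPoints.rank_le_card Γ E)
    refine rank_le_of_surjective_injective
      (R := E₀) (R' := FixedPoints.subfield Γ E) (M := E') (M₁ := E)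
      (fun x => ⟨⟨x.1, x.2.1⟩, fun σ => Subtype.ext (x.2.2 σ)⟩)
      { toFun := fun y => ⟨y.1, y.2⟩, map_zero' := rfl, map_add' := fun _ _ => rfl } ?_ ?_ ?_
    · rintro ⟨⟨y, hyE⟩, hy⟩
      exact ⟨⟨y, hyE, fun σ => congrArg Subtype.val (hy σ)⟩, rfl⟩
    · intro y₁ y₂ h
      exact Subtype.ext (congrArg Subtype.val h)
    · intro r m
      rfl
  haveI : Module.Finite E₀ E' := by
    rw [← Module.rank_lt_aleph0_iff]
    exact lt_of_le_of_lt hrankE (Cardinal.natCast_lt_aleph0 (n := _))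
  haveI : Algebra.IsAlgebraic E₀ E' := Algebra.IsAlgebraic.of_finite E₀ E'
  -- `P = L ∨ E₀` as an intermediate field over `E₀`; `Ω = P(E)` has `[Ω : P] ≤ [E : E₀] ≤ |Γ|`
  let P' : IntermediateField E₀ Ω :=
    P.toIntermediateField fun x => (le_sup_right : E₀ ≤ L ⊔ E₀) x.2
  have hadj : Module.rank P' (IntermediateField.adjoin P' (E' : Set Ω)) ≤ Module.rank E₀ E' :=
    IntermediateField.adjoin_rank_le_of_isAlgebraic_right P' E'
  have htop : IntermediateField.adjoin P' (E' : Set Ω) = ⊤ := by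
    rw [eq_top_iff]
    intro x _
    have hx : x ∈ L ⊔ E := by rw [hgen]; trivial
    have hle : L ⊔ E ≤ (IntermediateField.adjoin P' (E' : Set Ω)).toSubfield := by
      refine sup_le (fun y hy => ?_) (fun y hy => ?_)
      · have hyP : y ∈ P := (le_sup_left : L ≤ L ⊔ E₀) hy
        exact (IntermediateField.adjoin P' (E' : Set Ω)).algebraMap_mem ⟨y, hyP⟩
      · exact IntermediateField.subset_adjoin P' (E' : Set Ω) hy
    exact hle hx
  have hrankΩ : Module.rank P' Ω ≤ Fintype.card Γ := by
    rw [htop, IntermediateField.rank_top'] at hadj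
    exact hadj.trans hrankE
  haveI : Module.Finite P' Ω := by
    rw [← Module.rank_lt_aleph0_iff]
    exact lt_of_le_of_lt hrankΩ (Cardinal.natCast_lt_aleph0 (n := _))
  have hfinΩ : Module.finrank P' Ω ≤ Fintype.card Γ := Module.finrank_le_of_rank_le hrankΩ
  -- the tower `P ≤ Ω^Γ ≤ Ω` and Artin's theorem `[Ω : Ω^Γ] = |Γ|` force `P = Ω^Γ`
  let M' : IntermediateField P' Ω := MΓ.toIntermediateField fun x => hPM x.2
  have hArtin : Module.finrank M' Ω = Fintype.card Γ := FixedPoints.finrank_eq_card Γ Ω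
  have htower : Module.finrank P' M' * Module.finrank M' Ω = Module.finrank P' Ω :=
    Module.finrank_mul_finrank P' M' Ω
  have hPM1 : Module.finrank P' M' ≤ 1 := by
    have h := hfinΩ
    rw [← htower, hArtin] at h
    exact Nat.le_of_mul_le_mul_right (by simpa only [one_mul] using h) Fintype.card_pos
  haveI : FiniteDimensional P' M' := IntermediateField.finiteDimensional_left M'
  have h1 : Module.finrank P' M' = 1 := le_antisymm hPM1 Module.finrank_pos
  have hbot : M' = ⊥ := IntermediateField.finrank_eq_one_iff.mp h1
  intro x hx
  have hxM' : x ∈ M' := hx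
  rw [hbot, IntermediateField.mem_bot] at hxM'
  obtain ⟨y, rfl⟩ := hxM'
  exact y.2

/-! ## Separatedness descends along universally closed surjections; rigidity of dominant maps -/

universe u

/-- **Separatedness descends along a universally closed surjection**: if `f : X → Y` is
surjective and universally closed and `X` is separated, then `Y` is separated. Indeed
`Δ_Y(Y) = Δ_Y(f(X)) = (f × f)(Δ_X(X))` is closed, `f × f` being universally closed and `Δ_X(X)`
closed, and a diagonal with closed image is a closed immersion. (Applied to the proper surjective
semi-stable curve `X₁ → Y₁` with `X₁` projective.) [folklore] -/
theorem isSeparated_of_surjective_of_universallyClosed {X Y : Scheme.{u}} (f : X ⟶ Y)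
    [UniversallyClosed f] [Surjective f] [X.IsSeparated] : Y.IsSeparated := by
  refine ⟨⟨IsClosedImmersion.of_isPreimmersion _ ?_⟩⟩
  let F : pullback (terminal.from X) (terminal.from X) ⟶
      pullback (terminal.from Y) (terminal.from Y) :=
    pullback.map (terminal.from X) (terminal.from X) (terminal.from Y) (terminal.from Y) f f
      (𝟙 _) ((Category.comp_id _).trans (terminal.comp_from f).symm)
      ((Category.comp_id _).trans (terminal.comp_from f).symm)
  have hF : UniversallyClosed F :=
    MorphismProperty.pullbackMap (P := @UniversallyClosed) (inferInstance : UniversallyClosed f)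
      (inferInstance : UniversallyClosed f) (terminal.comp_from f).symm (terminal.comp_from f).symm
  have hcomm : pullback.diagonal (terminal.from X) ≫ F = f ≫ pullback.diagonal (terminal.from Y) := by
    apply pullback.hom_ext
    · rw [Category.assoc, Category.assoc, pullback.lift_fst, pullback.diagonal_fst_assoc,
        pullback.diagonal_fst, Category.comp_id]
    · rw [Category.assoc, Category.assoc, pullback.lift_snd, pullback.diagonal_snd_assoc,
        pullback.diagonal_snd, Category.comp_id]
  have hrange : Set.range (pullback.diagonal (terminal.from Y)) =
      F '' Set.range (pullback.diagonal (terminal.from X)) := by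
    rw [← Set.range_comp]
    change _ = Set.range ((pullback.diagonal (terminal.from X) ≫ F).base)
    rw [hcomm, Scheme.Hom.comp_base, TopCat.coe_comp, Set.range_comp,
      Set.range_eq_univ.mpr f.surjective, Set.image_univ]
  rw [hrange]
  exact F.isClosedMap _ (pullback.diagonal (terminal.from X)).isClosedEmbedding.isClosed_range

/-- **Dominant morphisms into a separated integral scheme are determined by their effect on
function fields**: if `α, β : Y' → Y` are dominant morphisms of integral schemes, `Y` separated,
with `α♯ = β♯ : K(Y) → K(Y')`, then `α = β`. Indeed both restrict along the dominant
`Spec K(Y') → Y'` to `Spec (α♯) ≫ (Spec K(Y) → Y)`, and a reduced source with separated target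
allows to conclude (`ext_of_isDominant`). (Applied in 5.4 to `ρ₂(g) ≫ ψ₂` and `ψ₂` for `g ∈ G₂`
acting trivially on `K(Y₁)`: such `g` acts on `Y₂` over `Y₁`.) [folklore] -/
theorem eq_of_functionFieldMap_eq {Y' Y : Scheme.{u}} [IsIntegral Y'] [IsIntegral Y]
    [Y.IsSeparated] (α β : Y' ⟶ Y) [IsDominant α] [IsDominant β]
    (h : RatFn.functionFieldMap α = RatFn.functionFieldMap β) : α = β := by
  have key : ∀ (γ : Y' ⟶ Y) [IsDominant γ], Y'.fromSpecStalk (genericPoint Y') ≫ γ =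
      Spec.map (CommRingCat.ofHom (RatFn.functionFieldMap γ)) ≫ Y.fromSpecStalk (genericPoint Y) := by
    intro γ _
    rw [← Scheme.SpecMap_stalkMap_fromSpecStalk,
      ← Scheme.SpecMap_stalkSpecializes_fromSpecStalk (Motives.RatFn.specializes_genericPoint γ),
      ← Category.assoc, ← Spec.map_comp]
    rfl
  haveI : IsDominant (Y'.fromSpecStalk (genericPoint Y')) := by
    refine ⟨?_⟩
    rw [DenseRange, Scheme.range_fromSpecStalk]
    have hd : Dense ({genericPoint Y'} : Set Y') := by
      rw [dense_iff_closure_eq]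
      exact (genericPoint_spec Y').def.trans Set.top_eq_univ
    exact hd.mono (Set.singleton_subset_iff.mpr specializes_rfl)
  exact ext_of_isDominant (Y'.fromSpecStalk (genericPoint Y')) (by rw [key α, key β, h])

end Summit.ResolutionOfSingularities.ResolutionOfSingularities.Theorems

end
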